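import Literature.NumberTheory.Automorphic.AsaiSignCont
import Literature.NumberTheory.Automorphic.AsaiEulerProductConvergence
import Mathlib.Analysis.Complex.RemovableSingularity
import HarnessLib

/-!
# Grbac–Shahidi 2015, Thm. 4.3 at `s = 1`, reduced to holomorphy: the Rankin–Selberg half of the
# proof (the identity `(∗∗)` and Remark 4.4) for the continued partial Asai `L`-functions

Topic `NumberTheory/Automorphic`; namespace `Literature.NumberTheory.Automorphic`. Proof file
(theorems only: no definition, no named fact, no instance), sibling of `AsaiSignContinuation`
(the named fact `GrbacShahidi2015_partialAsaiL_at_one`), `AsaiSignCont` (the Galois-self-dual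
stratum of that fact from Mok's dichotomy `Mok2014_partialAsaiL_continuation_pole_dichotomy`) and
`AsaiEulerProductConvergence` (clause (i) of the fact, proved for every cuspidal datum).

## What is proved, and what it isolates

`GrbacShahidi2015_partialAsaiL_at_one` renders Grbac–Shahidi 2015, Thm. 4.3 (1) and (2)(a)–(b)
**at `s = 1`** for the partial Asai `L`-functions `L^S(s, Π, As^η)` of a unitary cuspidal `Π` on
`GL_N(𝔸_E)`: (i) multipliability of the Euler product on a right half-plane; (ii) `k ≤ 1`, `δ > 0` and
`G` holomorphic on `{1 < Re s} ∪ B(1, δ)` with `G = (s - 1)^k L^S` far to the right and **`G(1) ≠ 0`**.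
The printed proof (pp. 204–206) has two halves:

* **holomorphy** (Thm. 4.1 — poles of the Siegel–parabolic Eisenstein series on `U_{2n}` — and
  Thm. 2.1 — its constant term `L(2s, σ, r_A)/L(1 + 2s, σ, r_A)` —, giving "`L(z, σ, r_A)` is
  holomorphic for `Re(z) > 0`, except for `z = 1` if the Eisenstein series has a pole at `s = 1/2`",
  p. 205; by Remark 4.2 and §4.C the part `Re(z) ≥ 1` of this does NOT need Mok's endoscopic
  classification: Harish-Chandra's criterion `σ^{w₀} ≅ σ` for non-Galois-self-dual `σ`, Kim's
  unitarity argument for `Re(s) ≥ 1/2` otherwise);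
* **orders and non-vanishing at `z = 1`** from the Rankin–Selberg identity
  `(∗∗) L(s, σ × σ^θ) = L(s, σ, r_A) L(s, σ, r_A ⊗ δ_{E/F})` (Goldberg) and Jacquet–Shalika: "For `σ`
  Galois self-dual it has a simple pole at `s = 1`. Since `σ ⊗ δ̂` is Galois self-dual as well, we
  already proved that both Asai `L`-functions on the right-hand side of `(∗∗)` have at most a simple
  pole at `s = 1`. Hence, they are both nonzero at `s = 1`, and exactly one of them has a simple pole
  at `s = 1`" (p. 206), and Remark 4.4: "Once the holomorphy of the Asai and twisted Asai `L`-function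
  is known at some `s₀` with `Re(s₀) > 0`, the argument using the Rankin–Selberg `L`-function at the
  end of this proof can be applied directly to obtain nonvanishing."

This file PROVES the second half in the tree's currency and thereby reduces the named fact to the
first (`GrbacShahidi2015_partialAsaiL_at_one_of_holomorphy`): the fact follows from

* `hHol` — **pure holomorphy** of the continued partial Asai `L`-functions near `{Re s ≥ 1}`: for
  every unitary cuspidal datum `Π`, Asai datum `(S, A)` and sign `η` there are `σ₀ ≥ 1`, `δ > 0` and
  `G` holomorphic on `{1 < Re s} ∪ B(1, δ)` with `G = (s - 1) L^S(s, Π, As^η)` on `{σ₀ < Re s}`, and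
  `G(1) = 0` unless `Π` is conjugate self-dual (a.e. on Satake parameters) — i.e. at most a simple
  pole at `s = 1`, and holomorphy at `1` in the non-self-dual case. This is exactly the holomorphy
  content of Thm. 4.3 (1) ("`L(s, σ, r_A)` is entire") and (2)(a) ("entire, except for possible
  simple poles at `s = 0` and `s = 1`") for the partial functions (finitely many reciprocal local
  factors, entire) of `Π = Π₁ ⊗ |det|^{it₀}`, `Π₁` normalised as on p. 190
  (`L^S(s, Π, As^η) = L^S(s + 2it₀, Π₁, As^η)`; for `t₀ ≠ 0` the possible pole `1 - 2it₀` lies on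
  `Re s = 1` off `B(1, δ)`, `δ < 2|t₀|`, and such a `Π` is not conjugate self-dual a.e.); no statement
  about zeros and no dichotomy is assumed;
* `hRS` — **Jacquet–Shalika for the pair `(Π, Π^c)` over `E`** (Arthur–Clozel, Ch. 3, (2.1)–(2.3);
  the `L`-function `L(s, σ × σ^θ)` of `(∗∗)`), for the raw partial product
  `R(s) = L^{S_E}(s, A ⊗ A^c) = partialPairL {w : w ∩ 𝓞 F ∈ S} A (A ∘ c)` off the places of `E` above
  `S`: multipliable and holomorphic on `{1 < Re s}`; `(s - 1) R(s) → r ≠ 0` (`s → 1`, `Re s > 1`) if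
  `Π` is conjugate self-dual a.e. (`1 ∈ X`), and `R(s) → r ≠ 0` otherwise (`1 ∉ X`) — the statements
  of the tree's `JacquetShalika1981_partialPairL_{multipliable,boundary,pole}_repData`
  (`PairLFunctionPolesRepData`; there for `S ⊇ S₀(Π, Π')` and unitary Satake families) for the pair
  `(Π, Π^c)` at `s₀ = 1`, whose `X`-membership test "`t_{Π,w} = t_{Π^c,w}⁻¹` a.e." is
  `IsConjSelfDualAE` (`t_{Π^c, w} = t_{Π, c w}`), plus holomorphy of the raw product on `{1 < Re s}`
  (locally uniform convergence, Jacquet–Shalika I, Thm. 5.3); it is kept as a hypothesis because the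
  tree has the Galois conjugate only for `L²` representations (`CuspidalAutomorphicRepGL.galConj`),
  not for Borel–Jacquet data.

Ingredients, all proved here or accepted: the factorisation
`L^{S_E}(s, A ⊗ A^c) = L^S(s, A, As⁺) L^S(s, A, As⁻)` on the common half-plane of convergence
(`partialPairL_smul_eq_partialAsaiL_mul`, `AsaiSign`), clause (i)
(`CuspidalAutomorphicRepData.exists_multipliable_asaiEulerFactors`, `AsaiEulerProductConvergence`), the
identity theorem from `{σ₀ < Re s}` down to `{1 < Re s}` (`eqOn_one_lt_re_of_eq_on_lt_re`), and the
**order count at `s = 1`** (`apply_one_mul_apply_one_eq_zero_of_pole`,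
`apply_one_mul_deriv_one_eq_of_pole`, `deriv_one_mul_deriv_one_eq_of_finite`): with `G_± = (s - 1) L_±`
holomorphic near `1` and `G₊ G₋ = (s - 1)² R`, a simple pole of `R` forces `G₊(1) G₋(1) = 0` and
`G_∓(1) · G_±'(1) = r ≠ 0`, a finite non-zero limit of `R` with `G_±(1) = 0` forces
`G₊'(1) G₋'(1) = r ≠ 0`; the holomorphic function `L_± = G_±/(s - 1)` at a simple zero of `G_±` is
Mathlib's `dslope G_± 1` (removable singularity, `Complex.differentiableOn_dslope`).

Conversely (`GrbacShahidi2015_partialAsaiL_at_one.hol_of_pairL`), the named fact together with `hRS`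
gives back `hHol` (off `X` a pole of one sign against the non-vanishing clause of the other sign would
make `L^{S_E}(s, Π × Π^c)` blow up at `1`, `eq_zero_of_clauses_of_pairL_finite`), so that **granted
`hRS` the fact is equivalent to `hHol`** (`GrbacShahidi2015_partialAsaiL_at_one_iff_holomorphy`); and
the conjugate-self-dual stratum of `hHol` is contained in Mok's dichotomy in continuation form
(`hol_of_Mok2014_partialAsaiL_continuation_pole_dichotomy`).

What this does NOT give: the fact itself. Its missing input is now exactly `hHol` for
NON-conjugate-self-dual `Π` — Thm. 4.3 (1), holomorphy part, for the partial functions: no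
declaration of the tree states it —, `Mok2014_partialAsaiL_continuation_pole_dichotomy` (a named fact
of the tree, unproved) for conjugate self-dual `Π`, and `hRS` (in the tree modulo the Galois-conjugate
datum `Π^c`).

## References

* N. Grbac, F. Shahidi, *Endoscopic transfer for unitary groups and holomorphy of Asai
  `L`-functions*, Pacific J. Math. 276 (2015), 185–211: Thm. 4.3 (pp. 186, 204), its proof
  pp. 204–206 with the identity `(∗∗)`, Remark 4.2 (pp. 203–204), Remark 4.4 and §4.C (p. 206).
  [GrbacShahidi2015]
* J. Arthur, L. Clozel, *Simple algebras, base change, and the advanced theory of the trace formula*,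
  Ann. of Math. Stud. 120 (1989), Ch. 3 §2, (2.1)–(2.3). [ArthurClozelAMS120]
* H. Jacquet, J. A. Shalika, *On Euler products and the classification of automorphic forms II*,
  Amer. J. Math. 103 (1981), Prop. 3.6. [JacquetShalikaAJM1981II]
* D. Goldberg, *Some results on reducibility for unitary groups and local Asai `L`-functions*,
  J. Reine Angew. Math. 448 (1994), 65–95 (the identity `(∗∗)`). [Goldberg1994]
* C. P. Mok, *Endoscopic classification of representations of quasi-split unitary groups*,
  Mem. Amer. Math. Soc. 235 (2015), no. 1108, §2.5 (factorisation before Thm. 2.5.4). [Mok2014]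
-/

noncomputable section

open scoped Topology
open NumberField IsDedekindDomain Filter

namespace Literature.NumberTheory.Automorphic

/-! ### Complex analysis on `{1 < Re s} ∪ B(1, δ)` -/

section Analysis

/-- The region `{1 < Re s} ∪ B(1, δ)` of `GrbacShahidi2015_partialAsaiL_at_one` is open. [folklore] -/
theorem isOpen_one_lt_re_union_ball (δ : ℝ) :
    IsOpen ({s : ℂ | 1 < s.re} ∪ Metric.ball (1 : ℂ) δ) :=
  (isOpen_lt continuous_const Complex.continuous_re).union Metric.isOpen_ball

/-- For `δ > 0` the region `{1 < Re s} ∪ B(1, δ)` is a neighbourhood of `1`. [folklore] -/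
theorem one_lt_re_union_ball_mem_nhds {δ : ℝ} (hδ : 0 < δ) :
    {s : ℂ | 1 < s.re} ∪ Metric.ball (1 : ℂ) δ ∈ 𝓝 (1 : ℂ) :=
  (isOpen_one_lt_re_union_ball δ).mem_nhds (Or.inr (Metric.mem_ball_self hδ))

/-- **Boundary value at `1`**: a function holomorphic on `{1 < Re s} ∪ B(1, δ)` tends to its value
at `1` along `s → 1`, `Re s > 1` (the filter of Arthur–Clozel (2.3)). [folklore] -/
theorem tendsto_nhdsWithin_one_lt_re_of_differentiableOn_union_ball {G : ℂ → ℂ} {δ : ℝ}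
    (hδ : 0 < δ) (hG : DifferentiableOn ℂ G ({s : ℂ | 1 < s.re} ∪ Metric.ball (1 : ℂ) δ)) :
    Tendsto G (𝓝[{s : ℂ | 1 < s.re}] 1) (𝓝 (G 1)) :=
  (hG.differentiableAt (one_lt_re_union_ball_mem_nhds hδ)).continuousAt.tendsto.mono_left
    nhdsWithin_le_nhds

/-- Along `s → 1`, `Re s > 1`, one has `s ≠ 1`. [folklore] -/
theorem eventually_ne_one_nhdsWithin_one_lt_re :
    ∀ᶠ s in 𝓝[{s : ℂ | 1 < s.re}] (1 : ℂ), s ≠ 1 :=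
  eventually_nhdsWithin_of_forall fun s hs h => by
    subst h
    simp at hs

/-- **Identity theorem from a right half-plane down to `{1 < Re s}`.** Two functions holomorphic on
the open half-plane `{1 < Re s}` which agree on `{σ < Re s}` (`σ ≥ 1`) agree on `{1 < Re s}` (the
half-plane is convex, hence preconnected, and `{σ < Re s}` is a neighbourhood of `σ + 1`). This is
how an identity between Euler products valid "for `Re s` large" is transported to the boundary
`Re s → 1⁺`. [folklore] -/
theorem eqOn_one_lt_re_of_eq_on_lt_re {Φ Ψ : ℂ → ℂ} {σ : ℝ} (hσ : 1 ≤ σ)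
    (hΦ : DifferentiableOn ℂ Φ {s : ℂ | 1 < s.re}) (hΨ : DifferentiableOn ℂ Ψ {s : ℂ | 1 < s.re})
    (h : ∀ s : ℂ, σ < s.re → Φ s = Ψ s) : Set.EqOn Φ Ψ {s : ℂ | 1 < s.re} := by
  have hV : IsOpen {s : ℂ | 1 < s.re} := isOpen_lt continuous_const Complex.continuous_re
  have hΦa : AnalyticOnNhd ℂ Φ {s : ℂ | 1 < s.re} := hΦ.analyticOnNhd hV
  have hΨa : AnalyticOnNhd ℂ Ψ {s : ℂ | 1 < s.re} := hΨ.analyticOnNhd hV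
  set z₀ : ℂ := ((σ + 1 : ℝ) : ℂ) with hz₀
  have hz₀re : z₀.re = σ + 1 := by simp [hz₀]
  have hz₀V : z₀ ∈ {s : ℂ | 1 < s.re} := by
    simp only [Set.mem_setOf_eq, hz₀re]
    linarith
  have hev : Φ =ᶠ[𝓝 z₀] Ψ := by
    have hmem : {s : ℂ | σ < s.re} ∈ 𝓝 z₀ :=
      (isOpen_lt continuous_const Complex.continuous_re).mem_nhds (by
        simp only [Set.mem_setOf_eq, hz₀re]
        linarith)
    exact Filter.eventually_of_mem hmem fun s hs => h s hs
  exact hΦa.eqOn_of_preconnected_of_eventuallyEq hΨa (convex_halfSpace_re_gt 1).isPreconnected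
    hz₀V hev

/-- Eventual form of `eqOn_one_lt_re_of_eq_on_lt_re` along `s → 1`, `Re s > 1`. [folklore] -/
theorem eventually_eq_nhdsWithin_one_of_eq_on_lt_re {Φ Ψ : ℂ → ℂ} {σ : ℝ} (hσ : 1 ≤ σ)
    (hΦ : DifferentiableOn ℂ Φ {s : ℂ | 1 < s.re}) (hΨ : DifferentiableOn ℂ Ψ {s : ℂ | 1 < s.re})
    (h : ∀ s : ℂ, σ < s.re → Φ s = Ψ s) :
    ∀ᶠ s in 𝓝[{s : ℂ | 1 < s.re}] (1 : ℂ), Φ s = Ψ s :=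
  eventually_nhdsWithin_of_forall fun _ hs => eqOn_one_lt_re_of_eq_on_lt_re hσ hΦ hΨ h hs

/-! ### Removing a simple zero at `s = 1`: `L = G / (s - 1)` as `dslope G 1` -/

/-- If `G` is holomorphic on `{1 < Re s} ∪ B(1, δ)` then so is `dslope G 1`, the function
`(G(s) - G(1))/(s - 1)` extended by `G'(1)` at `s = 1` (removable singularity,
`Complex.differentiableOn_dslope`). [folklore] -/
theorem differentiableOn_dslope_one {G : ℂ → ℂ} {δ : ℝ} (hδ : 0 < δ)
    (hG : DifferentiableOn ℂ G ({s : ℂ | 1 < s.re} ∪ Metric.ball (1 : ℂ) δ)) :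
    DifferentiableOn ℂ (dslope G 1) ({s : ℂ | 1 < s.re} ∪ Metric.ball (1 : ℂ) δ) :=
  (Complex.differentiableOn_dslope (one_lt_re_union_ball_mem_nhds hδ)).mpr hG

/-- If `G(1) = 0` and `G = (s - 1) · L` on `{σ < Re s}` (`σ ≥ 1`, so `s ≠ 1` there), then
`dslope G 1 = L` on `{σ < Re s}`: the continuation of `L` itself. [folklore] -/
theorem dslope_one_eq_of_eq_sub_one_mul {G L : ℂ → ℂ} {σ : ℝ} (hσ : 1 ≤ σ) (hG1 : G 1 = 0)
    (hGL : ∀ s : ℂ, σ < s.re → G s = (s - 1) * L s) {s : ℂ} (hs : σ < s.re) :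
    dslope G 1 s = L s := by
  have hs1 : s ≠ 1 := fun h => by
    rw [h, Complex.one_re] at hs
    linarith
  have hsub : s - 1 ≠ 0 := sub_ne_zero.mpr hs1
  have key := sub_smul_dslope G 1 s
  rw [smul_eq_mul, hG1, sub_zero, hGL s hs] at key
  exact mul_left_cancel₀ hsub key

/-! ### The order count at `s = 1` (Grbac–Shahidi, end of the proof of Thm. 4.3, and Remark 4.4) -/

/-- **A simple pole of the product kills exactly one value at `1`, first step: `G₁(1) G₂(1) = 0`.**
If `G₁`, `G₂` are holomorphic on `{1 < Re s} ∪ B(1, δ)`, `(s - 1) R(s) → r` as `s → 1`, `Re s > 1`,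
and `G₁ G₂ = (s - 1)² R` near `1` in `{1 < Re s}`, then `G₁(1) G₂(1) = lim (s - 1) · ((s - 1) R(s)) = 0`.
(With `G_i = (s - 1) L_i`: the product `L₁ L₂ = R` has at most a simple pole, so `L₁`, `L₂` cannot both
have one.) [cite: GrbacShahidi2015, proof of Thm. 4.3, p. 206] -/
theorem apply_one_mul_apply_one_eq_zero_of_pole {G₁ G₂ R : ℂ → ℂ} {δ : ℝ} {r : ℂ} (hδ : 0 < δ)
    (hG₁ : DifferentiableOn ℂ G₁ ({s : ℂ | 1 < s.re} ∪ Metric.ball (1 : ℂ) δ))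
    (hG₂ : DifferentiableOn ℂ G₂ ({s : ℂ | 1 < s.re} ∪ Metric.ball (1 : ℂ) δ))
    (hR : Tendsto (fun s => (s - 1) * R s) (𝓝[{s : ℂ | 1 < s.re}] 1) (𝓝 r))
    (hfac : ∀ᶠ s in 𝓝[{s : ℂ | 1 < s.re}] (1 : ℂ), G₁ s * G₂ s = (s - 1) ^ 2 * R s) :
    G₁ 1 * G₂ 1 = 0 := by
  have h1 : Tendsto (fun s => G₁ s * G₂ s) (𝓝[{s : ℂ | 1 < s.re}] 1) (𝓝 (G₁ 1 * G₂ 1)) :=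
    (tendsto_nhdsWithin_one_lt_re_of_differentiableOn_union_ball hδ hG₁).mul
      (tendsto_nhdsWithin_one_lt_re_of_differentiableOn_union_ball hδ hG₂)
  have h2 : Tendsto (fun s => (s - 1) ^ 2 * R s) (𝓝[{s : ℂ | 1 < s.re}] 1) (𝓝 0) := by
    have h := tendsto_sub_one_nhdsWithin_one_lt_re.mul hR
    rw [zero_mul] at h
    refine h.congr' (Eventually.of_forall fun s => ?_)
    ring
  exact tendsto_nhds_unique (h1.congr' hfac) h2

/-- **A simple pole of the product kills exactly one value at `1`, second step.** In the situation
of `apply_one_mul_apply_one_eq_zero_of_pole`, if `G₂(1) = 0` then `G₁(1) · G₂'(1) = r`: indeed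
`G₁(s) · (G₂(s) - G₂(1))/(s - 1) = G₁(s) G₂(s)/(s - 1) = (s - 1) R(s) → r`, while the left side
tends to `G₁(1) G₂'(1)`. Hence for `r ≠ 0`: `G₁(1) ≠ 0` (a simple pole of `L₁ = G₁/(s-1)` with
non-zero residue) and `G₂'(1) ≠ 0` (`L₂ = G₂/(s-1)` holomorphic and NON-ZERO at `1`) — "they are
both nonzero at `s = 1`, and exactly one of them has a simple pole at `s = 1`".
[cite: GrbacShahidi2015, proof of Thm. 4.3, p. 206] -/
theorem apply_one_mul_deriv_one_eq_of_pole {G₁ G₂ R : ℂ → ℂ} {δ : ℝ} {r : ℂ} (hδ : 0 < δ)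
    (hG₁ : DifferentiableOn ℂ G₁ ({s : ℂ | 1 < s.re} ∪ Metric.ball (1 : ℂ) δ))
    (hG₂ : DifferentiableOn ℂ G₂ ({s : ℂ | 1 < s.re} ∪ Metric.ball (1 : ℂ) δ))
    (hR : Tendsto (fun s => (s - 1) * R s) (𝓝[{s : ℂ | 1 < s.re}] 1) (𝓝 r))
    (hfac : ∀ᶠ s in 𝓝[{s : ℂ | 1 < s.re}] (1 : ℂ), G₁ s * G₂ s = (s - 1) ^ 2 * R s)
    (h2 : G₂ 1 = 0) : G₁ 1 * deriv G₂ 1 = r := by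
  have hD : DifferentiableOn ℂ (dslope G₂ 1) ({s : ℂ | 1 < s.re} ∪ Metric.ball (1 : ℂ) δ) :=
    differentiableOn_dslope_one hδ hG₂
  have hlim : Tendsto (fun s => G₁ s * dslope G₂ 1 s) (𝓝[{s : ℂ | 1 < s.re}] 1)
      (𝓝 (G₁ 1 * deriv G₂ 1)) := by
    have h := (tendsto_nhdsWithin_one_lt_re_of_differentiableOn_union_ball hδ hG₁).mul
      (tendsto_nhdsWithin_one_lt_re_of_differentiableOn_union_ball hδ hD)
    rwa [dslope_same] at h
  have hev : ∀ᶠ s in 𝓝[{s : ℂ | 1 < s.re}] (1 : ℂ), G₁ s * dslope G₂ 1 s = (s - 1) * R s := by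
    filter_upwards [hfac, eventually_ne_one_nhdsWithin_one_lt_re] with s hs hs1
    have hsub : s - 1 ≠ 0 := sub_ne_zero.mpr hs1
    have key : (s - 1) * dslope G₂ 1 s = G₂ s := by
      have h := sub_smul_dslope G₂ 1 s
      rwa [smul_eq_mul, h2, sub_zero] at h
    have hs' : (s - 1) * (G₁ s * dslope G₂ 1 s) = (s - 1) * ((s - 1) * R s) := by
      calc (s - 1) * (G₁ s * dslope G₂ 1 s) = G₁ s * ((s - 1) * dslope G₂ 1 s) := by ring
        _ = G₁ s * G₂ s := by rw [key]
        _ = (s - 1) ^ 2 * R s := hs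
        _ = (s - 1) * ((s - 1) * R s) := by ring
    exact mul_left_cancel₀ hsub hs'
  exact tendsto_nhds_unique (hlim.congr' hev) hR

/-- **A finite non-zero limit of the product with both factors vanishing at `1` to first order**
(Remark 4.4: holomorphy of both Asai `L`-functions at the point, then `(∗∗)` gives non-vanishing).
If `G₁`, `G₂` are holomorphic on `{1 < Re s} ∪ B(1, δ)` with `G₁(1) = G₂(1) = 0`, `R(s) → r` as
`s → 1`, `Re s > 1`, and `G₁ G₂ = (s - 1)² R` near `1` in `{1 < Re s}`, then `G₁'(1) G₂'(1) = r`: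
`(G₁(s)/(s-1)) (G₂(s)/(s-1)) = R(s)` and the left side tends to `G₁'(1) G₂'(1)`. For `r ≠ 0` both
`L_i = G_i/(s - 1)` are holomorphic and non-zero at `1`. [cite: GrbacShahidi2015, Remark 4.4, p. 206] -/
theorem deriv_one_mul_deriv_one_eq_of_finite {G₁ G₂ R : ℂ → ℂ} {δ : ℝ} {r : ℂ} (hδ : 0 < δ)
    (hG₁ : DifferentiableOn ℂ G₁ ({s : ℂ | 1 < s.re} ∪ Metric.ball (1 : ℂ) δ))
    (hG₂ : DifferentiableOn ℂ G₂ ({s : ℂ | 1 < s.re} ∪ Metric.ball (1 : ℂ) δ))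
    (hR : Tendsto R (𝓝[{s : ℂ | 1 < s.re}] 1) (𝓝 r))
    (hfac : ∀ᶠ s in 𝓝[{s : ℂ | 1 < s.re}] (1 : ℂ), G₁ s * G₂ s = (s - 1) ^ 2 * R s)
    (h1 : G₁ 1 = 0) (h2 : G₂ 1 = 0) : deriv G₁ 1 * deriv G₂ 1 = r := by
  have hD₁ : DifferentiableOn ℂ (dslope G₁ 1) ({s : ℂ | 1 < s.re} ∪ Metric.ball (1 : ℂ) δ) :=
    differentiableOn_dslope_one hδ hG₁
  have hD₂ : DifferentiableOn ℂ (dslope G₂ 1) ({s : ℂ | 1 < s.re} ∪ Metric.ball (1 : ℂ) δ) :=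
    differentiableOn_dslope_one hδ hG₂
  have hlim : Tendsto (fun s => dslope G₁ 1 s * dslope G₂ 1 s) (𝓝[{s : ℂ | 1 < s.re}] 1)
      (𝓝 (deriv G₁ 1 * deriv G₂ 1)) := by
    have h := (tendsto_nhdsWithin_one_lt_re_of_differentiableOn_union_ball hδ hD₁).mul
      (tendsto_nhdsWithin_one_lt_re_of_differentiableOn_union_ball hδ hD₂)
    rwa [dslope_same, dslope_same] at h
  have hev : ∀ᶠ s in 𝓝[{s : ℂ | 1 < s.re}] (1 : ℂ), dslope G₁ 1 s * dslope G₂ 1 s = R s := by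
    filter_upwards [hfac, eventually_ne_one_nhdsWithin_one_lt_re] with s hs hs1
    have hsub : (s - 1) ^ 2 ≠ 0 := pow_ne_zero 2 (sub_ne_zero.mpr hs1)
    have key₁ : (s - 1) * dslope G₁ 1 s = G₁ s := by
      have h := sub_smul_dslope G₁ 1 s
      rwa [smul_eq_mul, h1, sub_zero] at h
    have key₂ : (s - 1) * dslope G₂ 1 s = G₂ s := by
      have h := sub_smul_dslope G₂ 1 s
      rwa [smul_eq_mul, h2, sub_zero] at h
    have hs' : (s - 1) ^ 2 * (dslope G₁ 1 s * dslope G₂ 1 s) = (s - 1) ^ 2 * R s := by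
      calc (s - 1) ^ 2 * (dslope G₁ 1 s * dslope G₂ 1 s)
          = ((s - 1) * dslope G₁ 1 s) * ((s - 1) * dslope G₂ 1 s) := by ring
        _ = G₁ s * G₂ s := by rw [key₁, key₂]
        _ = (s - 1) ^ 2 * R s := hs
    exact mul_left_cancel₀ hsub hs'
  exact tendsto_nhds_unique (hlim.congr' hev) hR

/-- **No pole against a finite limit.** If `G₁`, `G₂` are holomorphic on `{1 < Re s} ∪ B(1, δ)`,
`R(s) → r` (finite) as `s → 1`, `Re s > 1`, and `G₁ G₂ = (s - 1)^{m+1} R` near `1` in `{1 < Re s}`,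
then `G₁(1) G₂(1) = 0`. (With `G₁ = (s - 1) L₁`, `G₁(1) ≠ 0` a genuine pole of `L₁`, and
`G₂ = (s - 1)^{k'} L₂` non-zero at `1`: impossible when `L₁ L₂ = R` stays finite — the converse
bookkeeping of Remark 4.4.) [folklore] -/
theorem apply_one_mul_apply_one_eq_zero_of_finite_pow {G₁ G₂ R : ℂ → ℂ} {δ : ℝ} {r : ℂ} {m : ℕ}
    (hδ : 0 < δ) (hG₁ : DifferentiableOn ℂ G₁ ({s : ℂ | 1 < s.re} ∪ Metric.ball (1 : ℂ) δ))
    (hG₂ : DifferentiableOn ℂ G₂ ({s : ℂ | 1 < s.re} ∪ Metric.ball (1 : ℂ) δ))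
    (hR : Tendsto R (𝓝[{s : ℂ | 1 < s.re}] 1) (𝓝 r))
    (hfac : ∀ᶠ s in 𝓝[{s : ℂ | 1 < s.re}] (1 : ℂ), G₁ s * G₂ s = (s - 1) ^ (m + 1) * R s) :
    G₁ 1 * G₂ 1 = 0 := by
  have h1 : Tendsto (fun s => G₁ s * G₂ s) (𝓝[{s : ℂ | 1 < s.re}] 1) (𝓝 (G₁ 1 * G₂ 1)) :=
    (tendsto_nhdsWithin_one_lt_re_of_differentiableOn_union_ball hδ hG₁).mul
      (tendsto_nhdsWithin_one_lt_re_of_differentiableOn_union_ball hδ hG₂)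
  have h2 : Tendsto (fun s => (s - 1) ^ (m + 1) * R s) (𝓝[{s : ℂ | 1 < s.re}] 1) (𝓝 0) := by
    have h := (tendsto_sub_one_nhdsWithin_one_lt_re.pow (m + 1)).mul hR
    rwa [zero_pow (Nat.succ_ne_zero m), zero_mul] at h
  exact tendsto_nhds_unique (h1.congr' hfac) h2

/-! ### The `s = 1` clause of the named fact for an abstract `L` -/

/-- **From the `s = 1` clause back to a continuation of `(s - 1) L`.** If `G` is holomorphic on
`{1 < Re s} ∪ B(1, δ)` with `G = (s - 1)^k L` on `{σ < Re s}`, `k ≤ 1`, then `(s - 1)^{1-k} G`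
continues `(s - 1) L`, and vanishes at `1` when `k = 0`. [folklore] -/
theorem exists_continuation_sub_one_mul_of_clause {L G : ℂ → ℂ} {σ δ : ℝ} {k : ℕ} (hk : k ≤ 1)
    (hG : DifferentiableOn ℂ G ({s : ℂ | 1 < s.re} ∪ Metric.ball (1 : ℂ) δ))
    (hGL : ∀ s : ℂ, σ < s.re → G s = (s - 1) ^ k * L s) :
    ∃ G' : ℂ → ℂ, DifferentiableOn ℂ G' ({s : ℂ | 1 < s.re} ∪ Metric.ball (1 : ℂ) δ) ∧
      (∀ s : ℂ, σ < s.re → G' s = (s - 1) * L s) ∧ (k = 0 → G' 1 = 0) := by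
  rcases Nat.le_one_iff_eq_zero_or_eq_one.mp hk with rfl | rfl
  · refine ⟨fun s => (s - 1) * G s, (differentiableOn_id.sub_const 1).mul hG, fun s hs => ?_,
      fun _ => by simp⟩
    show (s - 1) * G s = (s - 1) * L s
    rw [hGL s hs, pow_zero, one_mul]
  · exact ⟨G, hG, fun s hs => by rw [hGL s hs, pow_one], fun h => absurd h one_ne_zero⟩

/-- The `s = 1` clause of `GrbacShahidi2015_partialAsaiL_at_one` for an abstract `L`, **pole case
`k = 1`**: a continuation `G` of `(s - 1) L` to `{1 < Re s} ∪ B(1, δ)` with `G(1) ≠ 0`. [folklore] -/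
theorem exists_continuation_of_apply_one_ne_zero {G L : ℂ → ℂ} {δ σ : ℝ} (hδ : 0 < δ)
    (hG : DifferentiableOn ℂ G ({s : ℂ | 1 < s.re} ∪ Metric.ball (1 : ℂ) δ))
    (hGL : ∀ s : ℂ, σ < s.re → G s = (s - 1) * L s) (hG1 : G 1 ≠ 0) :
    ∃ (k : ℕ) (δ' : ℝ) (G' : ℂ → ℂ), k ≤ 1 ∧ 0 < δ' ∧
      DifferentiableOn ℂ G' ({s : ℂ | 1 < s.re} ∪ Metric.ball 1 δ') ∧
      (∀ s : ℂ, σ < s.re → G' s = (s - 1) ^ k * L s) ∧ G' 1 ≠ 0 :=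
  ⟨1, δ, G, le_rfl, hδ, hG, fun s hs => by rw [pow_one, hGL s hs], hG1⟩

/-- The `s = 1` clause of `GrbacShahidi2015_partialAsaiL_at_one` for an abstract `L`, **holomorphic
case `k = 0`**: if the continuation `G` of `(s - 1) L` has `G(1) = 0` and `G'(1) ≠ 0`, then
`dslope G 1` continues `L` itself, holomorphically and with the non-zero value `G'(1)` at `1`.
[folklore] -/
theorem exists_continuation_of_apply_one_eq_zero {G L : ℂ → ℂ} {δ σ : ℝ} (hδ : 0 < δ) (hσ : 1 ≤ σ)
    (hG : DifferentiableOn ℂ G ({s : ℂ | 1 < s.re} ∪ Metric.ball (1 : ℂ) δ))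
    (hGL : ∀ s : ℂ, σ < s.re → G s = (s - 1) * L s) (hG1 : G 1 = 0) (hG1' : deriv G 1 ≠ 0) :
    ∃ (k : ℕ) (δ' : ℝ) (G' : ℂ → ℂ), k ≤ 1 ∧ 0 < δ' ∧
      DifferentiableOn ℂ G' ({s : ℂ | 1 < s.re} ∪ Metric.ball 1 δ') ∧
      (∀ s : ℂ, σ < s.re → G' s = (s - 1) ^ k * L s) ∧ G' 1 ≠ 0 :=
  ⟨0, δ, dslope G 1, zero_le_one, hδ, differentiableOn_dslope_one hδ hG,
    fun s hs => by rw [pow_zero, one_mul, dslope_one_eq_of_eq_sub_one_mul hσ hG1 hGL hs],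
    by rw [dslope_same]; exact hG1'⟩

/-- **Both functions at once, pole case** ("exactly one of them has a simple pole at `s = 1`",
and both continued functions are non-zero at `1`): from continuations `G_i` of `(s - 1) L_i`
(`i = 1, 2`), a simple pole of `R` at `1` along `Re s → 1⁺` and `G₁ G₂ = (s - 1)² R` there, the
`s = 1` clause of the named fact holds for `L₁` and for `L₂`. [cite: GrbacShahidi2015, proof of Thm. 4.3, p. 206] -/
theorem exists_continuation_of_pole {G₁ G₂ L₁ L₂ R : ℂ → ℂ} {δ σ : ℝ} {r : ℂ} (hδ : 0 < δ)
    (hσ : 1 ≤ σ) (hG₁ : DifferentiableOn ℂ G₁ ({s : ℂ | 1 < s.re} ∪ Metric.ball (1 : ℂ) δ))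
    (hG₂ : DifferentiableOn ℂ G₂ ({s : ℂ | 1 < s.re} ∪ Metric.ball (1 : ℂ) δ))
    (hGL₁ : ∀ s : ℂ, σ < s.re → G₁ s = (s - 1) * L₁ s)
    (hGL₂ : ∀ s : ℂ, σ < s.re → G₂ s = (s - 1) * L₂ s) (hr : r ≠ 0)
    (hR : Tendsto (fun s => (s - 1) * R s) (𝓝[{s : ℂ | 1 < s.re}] 1) (𝓝 r))
    (hfac : ∀ᶠ s in 𝓝[{s : ℂ | 1 < s.re}] (1 : ℂ), G₁ s * G₂ s = (s - 1) ^ 2 * R s) :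
    (∃ (k : ℕ) (δ' : ℝ) (G' : ℂ → ℂ), k ≤ 1 ∧ 0 < δ' ∧
      DifferentiableOn ℂ G' ({s : ℂ | 1 < s.re} ∪ Metric.ball 1 δ') ∧
      (∀ s : ℂ, σ < s.re → G' s = (s - 1) ^ k * L₁ s) ∧ G' 1 ≠ 0) ∧
    (∃ (k : ℕ) (δ' : ℝ) (G' : ℂ → ℂ), k ≤ 1 ∧ 0 < δ' ∧
      DifferentiableOn ℂ G' ({s : ℂ | 1 < s.re} ∪ Metric.ball 1 δ') ∧
      (∀ s : ℂ, σ < s.re → G' s = (s - 1) ^ k * L₂ s) ∧ G' 1 ≠ 0) := by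
  have h0 := apply_one_mul_apply_one_eq_zero_of_pole hδ hG₁ hG₂ hR hfac
  rcases mul_eq_zero.mp h0 with h1 | h2
  · have hfac' : ∀ᶠ s in 𝓝[{s : ℂ | 1 < s.re}] (1 : ℂ), G₂ s * G₁ s = (s - 1) ^ 2 * R s :=
      hfac.mono fun s hs => by rw [mul_comm, hs]
    have key := apply_one_mul_deriv_one_eq_of_pole hδ hG₂ hG₁ hR hfac' h1
    have hG₂1 : G₂ 1 ≠ 0 := fun h => hr (by rw [← key, h, zero_mul])
    have hd : deriv G₁ 1 ≠ 0 := fun h => hr (by rw [← key, h, mul_zero])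
    exact ⟨exists_continuation_of_apply_one_eq_zero hδ hσ hG₁ hGL₁ h1 hd,
      exists_continuation_of_apply_one_ne_zero hδ hG₂ hGL₂ hG₂1⟩
  · have key := apply_one_mul_deriv_one_eq_of_pole hδ hG₁ hG₂ hR hfac h2
    have hG₁1 : G₁ 1 ≠ 0 := fun h => hr (by rw [← key, h, zero_mul])
    have hd : deriv G₂ 1 ≠ 0 := fun h => hr (by rw [← key, h, mul_zero])
    exact ⟨exists_continuation_of_apply_one_ne_zero hδ hG₁ hGL₁ hG₁1,
      exists_continuation_of_apply_one_eq_zero hδ hσ hG₂ hGL₂ h2 hd⟩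

/-- **Both functions at once, finite case** (Remark 4.4): from continuations `G_i` of `(s - 1) L_i`
with `G_i(1) = 0` (`L_i` holomorphic at `1`), a finite non-zero limit of `R` at `1` along
`Re s → 1⁺` and `G₁ G₂ = (s - 1)² R` there, the `s = 1` clause of the named fact holds for `L₁` and
for `L₂`, both with `k = 0`. [cite: GrbacShahidi2015, Remark 4.4, p. 206] -/
theorem exists_continuation_of_finite {G₁ G₂ L₁ L₂ R : ℂ → ℂ} {δ σ : ℝ} {r : ℂ} (hδ : 0 < δ)
    (hσ : 1 ≤ σ) (hG₁ : DifferentiableOn ℂ G₁ ({s : ℂ | 1 < s.re} ∪ Metric.ball (1 : ℂ) δ))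
    (hG₂ : DifferentiableOn ℂ G₂ ({s : ℂ | 1 < s.re} ∪ Metric.ball (1 : ℂ) δ))
    (hGL₁ : ∀ s : ℂ, σ < s.re → G₁ s = (s - 1) * L₁ s)
    (hGL₂ : ∀ s : ℂ, σ < s.re → G₂ s = (s - 1) * L₂ s) (hr : r ≠ 0)
    (hR : Tendsto R (𝓝[{s : ℂ | 1 < s.re}] 1) (𝓝 r))
    (hfac : ∀ᶠ s in 𝓝[{s : ℂ | 1 < s.re}] (1 : ℂ), G₁ s * G₂ s = (s - 1) ^ 2 * R s)
    (h1 : G₁ 1 = 0) (h2 : G₂ 1 = 0) :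
    (∃ (k : ℕ) (δ' : ℝ) (G' : ℂ → ℂ), k ≤ 1 ∧ 0 < δ' ∧
      DifferentiableOn ℂ G' ({s : ℂ | 1 < s.re} ∪ Metric.ball 1 δ') ∧
      (∀ s : ℂ, σ < s.re → G' s = (s - 1) ^ k * L₁ s) ∧ G' 1 ≠ 0) ∧
    (∃ (k : ℕ) (δ' : ℝ) (G' : ℂ → ℂ), k ≤ 1 ∧ 0 < δ' ∧
      DifferentiableOn ℂ G' ({s : ℂ | 1 < s.re} ∪ Metric.ball 1 δ') ∧
      (∀ s : ℂ, σ < s.re → G' s = (s - 1) ^ k * L₂ s) ∧ G' 1 ≠ 0) := by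
  have key := deriv_one_mul_deriv_one_eq_of_finite hδ hG₁ hG₂ hR hfac h1 h2
  have hd₁ : deriv G₁ 1 ≠ 0 := fun h => hr (by rw [← key, h, zero_mul])
  have hd₂ : deriv G₂ 1 ≠ 0 := fun h => hr (by rw [← key, h, mul_zero])
  exact ⟨exists_continuation_of_apply_one_eq_zero hδ hσ hG₁ hGL₁ h1 hd₁,
    exists_continuation_of_apply_one_eq_zero hδ hσ hG₂ hGL₂ h2 hd₂⟩

end Analysis

/-! ### The identity `(∗∗)` for the continuations, and the `s = 1` clause for a Satake family -/

section Asai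

variable {F E : Type} [Field F] [NumberField F] [Field E] [NumberField E] [Algebra F E]

/-- **`(∗∗)` for the continuations, near `s = 1`.** For `[E : F] = 2`, `c ≠ 1`, a set `S` of finite
places of `F` off which the `c`-fixed places are inert, a Satake family `A` over `E`, `σ ≥ 1` beyond
which the two partial Asai products and the partial Rankin–Selberg product
`R(s) = L^{S_E}(s, A ⊗ A^c)` are multipliable, `R` holomorphic on `{1 < Re s}`, and continuations
`G_±` of `(s - 1) L^S(s, A, As^±)` holomorphic on `{1 < Re s} ∪ B(1, δ)`: then
`G₊(s) G₋(s) = (s - 1)² R(s)` for all `s` near `1` with `Re s > 1`. On `{σ < Re s}` this is the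
factorisation `L^{S_E}(s, A ⊗ A^c) = L^S(s, A, As⁺) L^S(s, A, As⁻)`
(`partialPairL_smul_eq_partialAsaiL_mul`; Grbac–Shahidi's `(∗∗)`, Goldberg; Mok §2.5); it descends
to `{1 < Re s}` by the identity theorem. [cite: GrbacShahidi2015, proof of Thm. 4.3, (∗∗) p. 205]
[cite: Mok2014, §2.5, factorisation before Thm. 2.5.4] -/
theorem eventually_mul_eq_sq_mul_partialPairL (h2 : Module.finrank F E = 2) {c : E ≃ₐ[F] E}
    (hc : c ≠ 1) {S : Set (HeightOneSpectrum (𝓞 F))} {A : SatakeFamily E}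
    (hinert : ∀ w : HeightOneSpectrum (𝓞 E), w.under (𝓞 F) ∉ S → c • w = w →
      w.asIdeal.inertiaDeg (𝓞 F) = 2)
    {σ δ : ℝ} (hσ : 1 ≤ σ)
    (hmulA : ∀ (θ : ℤˣ) (s : ℂ), σ < s.re →
      Multipliable fun v : {v : HeightOneSpectrum (𝓞 F) // v ∉ S} =>
        ((asaiLocalPolynomial c A θ (placeAbove E v.1)).eval ((v.1.residueCard : ℂ) ^ (-s)))⁻¹)
    (hmulP : ∀ s : ℂ, σ < s.re →
      Multipliable fun w : {w : HeightOneSpectrum (𝓞 E) // w.under (𝓞 F) ∉ S} =>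
        ((satakePairPolynomial (A w.1) (A (c • w.1))).eval ((w.1.residueCard : ℂ) ^ (-s)))⁻¹)
    (hRhol : DifferentiableOn ℂ
      (partialPairL {w : HeightOneSpectrum (𝓞 E) | w.under (𝓞 F) ∈ S} A (fun w => A (c • w)))
      {s : ℂ | 1 < s.re})
    {G₁ G₂ : ℂ → ℂ} (hG₁ : DifferentiableOn ℂ G₁ ({s : ℂ | 1 < s.re} ∪ Metric.ball (1 : ℂ) δ))
    (hG₂ : DifferentiableOn ℂ G₂ ({s : ℂ | 1 < s.re} ∪ Metric.ball (1 : ℂ) δ))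
    (hGL₁ : ∀ s : ℂ, σ < s.re → G₁ s = (s - 1) * partialAsaiL S c A 1 s)
    (hGL₂ : ∀ s : ℂ, σ < s.re → G₂ s = (s - 1) * partialAsaiL S c A (-1) s) :
    ∀ᶠ s in 𝓝[{s : ℂ | 1 < s.re}] (1 : ℂ), G₁ s * G₂ s =
      (s - 1) ^ 2 * partialPairL {w : HeightOneSpectrum (𝓞 E) | w.under (𝓞 F) ∈ S} A
        (fun w => A (c • w)) s := by
  refine eventually_eq_nhdsWithin_one_of_eq_on_lt_re (Φ := fun s => G₁ s * G₂ s)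
    (Ψ := fun s => (s - 1) ^ 2 * partialPairL {w : HeightOneSpectrum (𝓞 E) | w.under (𝓞 F) ∈ S} A
      (fun w => A (c • w)) s) hσ ?_ ?_ (fun s hs => ?_)
  · exact (hG₁.mono Set.subset_union_left).mul (hG₂.mono Set.subset_union_left)
  · exact ((differentiableOn_id.sub_const 1).pow 2).mul hRhol
  · rw [hGL₁ s hs, hGL₂ s hs, partialPairL_smul_eq_partialAsaiL_mul h2 hc S A hinert (hmulP s hs)
      (hmulA 1 s hs) (hmulA (-1) s hs)]
    ring

/-- **The `s = 1` clause of `GrbacShahidi2015_partialAsaiL_at_one` for both signs, from holomorphy,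
when `L^{S_E}(s, A ⊗ A^c)` has a simple pole at `1`** (the conjugate self-dual case, Arthur–Clozel
(2.3)): given continuations `G_±` of `(s - 1) L^S(s, A, As^±)` to `{1 < Re s} ∪ B(1, δ)` (at most a
simple pole at `1`; nothing assumed about their values), for every sign `η` there are `k ≤ 1`,
`δ' > 0` and `G` holomorphic on `{1 < Re s} ∪ B(1, δ')` with `G = (s - 1)^k L^S(s, A, As^η)` on
`{σ < Re s}` and `G(1) ≠ 0` — exactly one sign getting `k = 1`.
[cite: GrbacShahidi2015, proof of Thm. 4.3, p. 206] [cite: ArthurClozelAMS120, Ch. 3 §2 (2.3)] -/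
theorem exists_continuation_partialAsaiL_at_one_of_pairL_pole (h2 : Module.finrank F E = 2)
    {c : E ≃ₐ[F] E} (hc : c ≠ 1) {S : Set (HeightOneSpectrum (𝓞 F))} {A : SatakeFamily E}
    (hinert : ∀ w : HeightOneSpectrum (𝓞 E), w.under (𝓞 F) ∉ S → c • w = w →
      w.asIdeal.inertiaDeg (𝓞 F) = 2)
    {σ δ : ℝ} (hσ : 1 ≤ σ) (hδ : 0 < δ)
    (hmulA : ∀ (θ : ℤˣ) (s : ℂ), σ < s.re →
      Multipliable fun v : {v : HeightOneSpectrum (𝓞 F) // v ∉ S} =>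
        ((asaiLocalPolynomial c A θ (placeAbove E v.1)).eval ((v.1.residueCard : ℂ) ^ (-s)))⁻¹)
    (hmulP : ∀ s : ℂ, σ < s.re →
      Multipliable fun w : {w : HeightOneSpectrum (𝓞 E) // w.under (𝓞 F) ∉ S} =>
        ((satakePairPolynomial (A w.1) (A (c • w.1))).eval ((w.1.residueCard : ℂ) ^ (-s)))⁻¹)
    (hRhol : DifferentiableOn ℂ
      (partialPairL {w : HeightOneSpectrum (𝓞 E) | w.under (𝓞 F) ∈ S} A (fun w => A (c • w)))
      {s : ℂ | 1 < s.re})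
    {r : ℂ} (hr : r ≠ 0)
    (hpole : Tendsto (fun s => (s - 1) *
        partialPairL {w : HeightOneSpectrum (𝓞 E) | w.under (𝓞 F) ∈ S} A (fun w => A (c • w)) s)
      (𝓝[{s : ℂ | 1 < s.re}] 1) (𝓝 r))
    {G₁ G₂ : ℂ → ℂ} (hG₁ : DifferentiableOn ℂ G₁ ({s : ℂ | 1 < s.re} ∪ Metric.ball (1 : ℂ) δ))
    (hG₂ : DifferentiableOn ℂ G₂ ({s : ℂ | 1 < s.re} ∪ Metric.ball (1 : ℂ) δ))
    (hGL₁ : ∀ s : ℂ, σ < s.re → G₁ s = (s - 1) * partialAsaiL S c A 1 s)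
    (hGL₂ : ∀ s : ℂ, σ < s.re → G₂ s = (s - 1) * partialAsaiL S c A (-1) s) (η : ℤˣ) :
    ∃ (k : ℕ) (δ' : ℝ) (G : ℂ → ℂ), k ≤ 1 ∧ 0 < δ' ∧
      DifferentiableOn ℂ G ({s : ℂ | 1 < s.re} ∪ Metric.ball 1 δ') ∧
      (∀ s : ℂ, σ < s.re → G s = (s - 1) ^ k * partialAsaiL S c A η s) ∧ G 1 ≠ 0 := by
  have hfac := eventually_mul_eq_sq_mul_partialPairL h2 hc hinert hσ hmulA hmulP hRhol hG₁ hG₂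
    hGL₁ hGL₂
  obtain ⟨hp, hm⟩ := exists_continuation_of_pole hδ hσ hG₁ hG₂ hGL₁ hGL₂ hr hpole hfac
  rcases Int.units_eq_one_or η with rfl | rfl
  · exact hp
  · exact hm

/-- **The `s = 1` clause of `GrbacShahidi2015_partialAsaiL_at_one` for both signs, from holomorphy,
when `L^{S_E}(s, A ⊗ A^c)` is finite and non-zero at `1`** (the non-conjugate-self-dual case,
Arthur–Clozel (2.2) at `s₀ = 1 ∉ X`; Grbac–Shahidi Remark 4.4): given continuations `G_±` of
`(s - 1) L^S(s, A, As^±)` to `{1 < Re s} ∪ B(1, δ)` **vanishing at `1`** (both partial Asai functions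
holomorphic at `1`, Thm. 4.3 (1)), for every sign `η` the clause holds with `k = 0` and a
continuation non-zero at `1`. [cite: GrbacShahidi2015, Remark 4.4, p. 206]
[cite: ArthurClozelAMS120, Ch. 3 §2 (2.2)] -/
theorem exists_continuation_partialAsaiL_at_one_of_pairL_finite (h2 : Module.finrank F E = 2)
    {c : E ≃ₐ[F] E} (hc : c ≠ 1) {S : Set (HeightOneSpectrum (𝓞 F))} {A : SatakeFamily E}
    (hinert : ∀ w : HeightOneSpectrum (𝓞 E), w.under (𝓞 F) ∉ S → c • w = w →
      w.asIdeal.inertiaDeg (𝓞 F) = 2)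
    {σ δ : ℝ} (hσ : 1 ≤ σ) (hδ : 0 < δ)
    (hmulA : ∀ (θ : ℤˣ) (s : ℂ), σ < s.re →
      Multipliable fun v : {v : HeightOneSpectrum (𝓞 F) // v ∉ S} =>
        ((asaiLocalPolynomial c A θ (placeAbove E v.1)).eval ((v.1.residueCard : ℂ) ^ (-s)))⁻¹)
    (hmulP : ∀ s : ℂ, σ < s.re →
      Multipliable fun w : {w : HeightOneSpectrum (𝓞 E) // w.under (𝓞 F) ∉ S} =>
        ((satakePairPolynomial (A w.1) (A (c • w.1))).eval ((w.1.residueCard : ℂ) ^ (-s)))⁻¹)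
    (hRhol : DifferentiableOn ℂ
      (partialPairL {w : HeightOneSpectrum (𝓞 E) | w.under (𝓞 F) ∈ S} A (fun w => A (c • w)))
      {s : ℂ | 1 < s.re})
    {r : ℂ} (hr : r ≠ 0)
    (hfin : Tendsto
      (partialPairL {w : HeightOneSpectrum (𝓞 E) | w.under (𝓞 F) ∈ S} A (fun w => A (c • w)))
      (𝓝[{s : ℂ | 1 < s.re}] 1) (𝓝 r))
    {G₁ G₂ : ℂ → ℂ} (hG₁ : DifferentiableOn ℂ G₁ ({s : ℂ | 1 < s.re} ∪ Metric.ball (1 : ℂ) δ))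
    (hG₂ : DifferentiableOn ℂ G₂ ({s : ℂ | 1 < s.re} ∪ Metric.ball (1 : ℂ) δ))
    (hGL₁ : ∀ s : ℂ, σ < s.re → G₁ s = (s - 1) * partialAsaiL S c A 1 s)
    (hGL₂ : ∀ s : ℂ, σ < s.re → G₂ s = (s - 1) * partialAsaiL S c A (-1) s)
    (hG₁1 : G₁ 1 = 0) (hG₂1 : G₂ 1 = 0) (η : ℤˣ) :
    ∃ (k : ℕ) (δ' : ℝ) (G : ℂ → ℂ), k ≤ 1 ∧ 0 < δ' ∧
      DifferentiableOn ℂ G ({s : ℂ | 1 < s.re} ∪ Metric.ball 1 δ') ∧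
      (∀ s : ℂ, σ < s.re → G s = (s - 1) ^ k * partialAsaiL S c A η s) ∧ G 1 ≠ 0 := by
  have hfac := eventually_mul_eq_sq_mul_partialPairL h2 hc hinert hσ hmulA hmulP hRhol hG₁ hG₂
    hGL₁ hGL₂
  obtain ⟨hp, hm⟩ := exists_continuation_of_finite hδ hσ hG₁ hG₂ hGL₁ hGL₂ hr hfin hfac hG₁1 hG₂1
  rcases Int.units_eq_one_or η with rfl | rfl
  · exact hp
  · exact hm

/-! ### Conversely: the `s = 1` clauses for both signs control the pole (`k = 0` off `X`) -/

/-- **`(∗∗)` for the `s = 1` clauses, near `1`.** With `G = (s - 1)^k L^S(s, A, As^η)` and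
`G' = (s - 1)^{k'} L^S(s, A, As^{-η})` on `{σ < Re s}`, both holomorphic on `{1 < Re s} ∪ B(1, δ)`,
and `R = L^{S_E}(s, A ⊗ A^c)` holomorphic on `{1 < Re s}`: `G G' = (s - 1)^{k+k'} R` near `1` in
`{1 < Re s}` (factorisation `partialPairL_smul_eq_partialAsaiL_mul` on `{σ < Re s}`, in either order
of the signs, then the identity theorem). [cite: GrbacShahidi2015, proof of Thm. 4.3, (∗∗) p. 205] -/
theorem eventually_mul_eq_pow_mul_partialPairL (h2 : Module.finrank F E = 2) {c : E ≃ₐ[F] E}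
    (hc : c ≠ 1) {S : Set (HeightOneSpectrum (𝓞 F))} {A : SatakeFamily E}
    (hinert : ∀ w : HeightOneSpectrum (𝓞 E), w.under (𝓞 F) ∉ S → c • w = w →
      w.asIdeal.inertiaDeg (𝓞 F) = 2)
    {σ δ : ℝ} (hσ : 1 ≤ σ)
    (hmulA : ∀ (θ : ℤˣ) (s : ℂ), σ < s.re →
      Multipliable fun v : {v : HeightOneSpectrum (𝓞 F) // v ∉ S} =>
        ((asaiLocalPolynomial c A θ (placeAbove E v.1)).eval ((v.1.residueCard : ℂ) ^ (-s)))⁻¹)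
    (hmulP : ∀ s : ℂ, σ < s.re →
      Multipliable fun w : {w : HeightOneSpectrum (𝓞 E) // w.under (𝓞 F) ∉ S} =>
        ((satakePairPolynomial (A w.1) (A (c • w.1))).eval ((w.1.residueCard : ℂ) ^ (-s)))⁻¹)
    (hRhol : DifferentiableOn ℂ
      (partialPairL {w : HeightOneSpectrum (𝓞 E) | w.under (𝓞 F) ∈ S} A (fun w => A (c • w)))
      {s : ℂ | 1 < s.re})
    {η : ℤˣ} {k k' : ℕ} {G G' : ℂ → ℂ}
    (hG : DifferentiableOn ℂ G ({s : ℂ | 1 < s.re} ∪ Metric.ball (1 : ℂ) δ))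
    (hG' : DifferentiableOn ℂ G' ({s : ℂ | 1 < s.re} ∪ Metric.ball (1 : ℂ) δ))
    (hGL : ∀ s : ℂ, σ < s.re → G s = (s - 1) ^ k * partialAsaiL S c A η s)
    (hGL' : ∀ s : ℂ, σ < s.re → G' s = (s - 1) ^ k' * partialAsaiL S c A (-η) s) :
    ∀ᶠ s in 𝓝[{s : ℂ | 1 < s.re}] (1 : ℂ), G s * G' s =
      (s - 1) ^ (k + k') * partialPairL {w : HeightOneSpectrum (𝓞 E) | w.under (𝓞 F) ∈ S} A
        (fun w => A (c • w)) s := by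
  have hprod : ∀ s : ℂ, σ < s.re → partialAsaiL S c A η s * partialAsaiL S c A (-η) s =
      partialPairL {w : HeightOneSpectrum (𝓞 E) | w.under (𝓞 F) ∈ S} A (fun w => A (c • w)) s := by
    intro s hs
    rw [partialPairL_smul_eq_partialAsaiL_mul h2 hc S A hinert (hmulP s hs) (hmulA 1 s hs)
      (hmulA (-1) s hs)]
    rcases Int.units_eq_one_or η with rfl | rfl
    · rfl
    · rw [neg_neg, mul_comm]
  refine eventually_eq_nhdsWithin_one_of_eq_on_lt_re (Φ := fun s => G s * G' s)
    (Ψ := fun s => (s - 1) ^ (k + k') *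
      partialPairL {w : HeightOneSpectrum (𝓞 E) | w.under (𝓞 F) ∈ S} A (fun w => A (c • w)) s)
    hσ ?_ ?_ (fun s hs => ?_)
  · exact (hG.mono Set.subset_union_left).mul (hG'.mono Set.subset_union_left)
  · exact ((differentiableOn_id.sub_const 1).pow (k + k')).mul hRhol
  · rw [hGL s hs, hGL' s hs, ← hprod s hs]
    ring

/-- **Off `X` there is no pole: `k = 0`.** If the `s = 1` clauses hold for the signs `η` (with
exponent `k` and `G(1) ≠ 0`) and `-η` (exponent `k'`, `G'(1) ≠ 0`), while the Rankin–Selberg product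
`R = L^{S_E}(s, A ⊗ A^c)` has a FINITE limit at `1` along `Re s → 1⁺` (Arthur–Clozel (2.2), `1 ∉ X`),
then `k = 0`: otherwise `G G' = (s - 1)^{k+k'} R → 0` at `1` while `G(1) G'(1) ≠ 0`
(`apply_one_mul_apply_one_eq_zero_of_finite_pow`). [cite: GrbacShahidi2015, Remark 4.4, p. 206]
[cite: ArthurClozelAMS120, Ch. 3 §2 (2.2)] -/
theorem eq_zero_of_clauses_of_pairL_finite (h2 : Module.finrank F E = 2) {c : E ≃ₐ[F] E}
    (hc : c ≠ 1) {S : Set (HeightOneSpectrum (𝓞 F))} {A : SatakeFamily E}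
    (hinert : ∀ w : HeightOneSpectrum (𝓞 E), w.under (𝓞 F) ∉ S → c • w = w →
      w.asIdeal.inertiaDeg (𝓞 F) = 2)
    {σ δ : ℝ} (hσ : 1 ≤ σ) (hδ : 0 < δ)
    (hmulA : ∀ (θ : ℤˣ) (s : ℂ), σ < s.re →
      Multipliable fun v : {v : HeightOneSpectrum (𝓞 F) // v ∉ S} =>
        ((asaiLocalPolynomial c A θ (placeAbove E v.1)).eval ((v.1.residueCard : ℂ) ^ (-s)))⁻¹)
    (hmulP : ∀ s : ℂ, σ < s.re →
      Multipliable fun w : {w : HeightOneSpectrum (𝓞 E) // w.under (𝓞 F) ∉ S} =>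
        ((satakePairPolynomial (A w.1) (A (c • w.1))).eval ((w.1.residueCard : ℂ) ^ (-s)))⁻¹)
    (hRhol : DifferentiableOn ℂ
      (partialPairL {w : HeightOneSpectrum (𝓞 E) | w.under (𝓞 F) ∈ S} A (fun w => A (c • w)))
      {s : ℂ | 1 < s.re})
    {r : ℂ} (hfin : Tendsto
      (partialPairL {w : HeightOneSpectrum (𝓞 E) | w.under (𝓞 F) ∈ S} A (fun w => A (c • w)))
      (𝓝[{s : ℂ | 1 < s.re}] 1) (𝓝 r))
    {η : ℤˣ} {k k' : ℕ} {G G' : ℂ → ℂ}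
    (hG : DifferentiableOn ℂ G ({s : ℂ | 1 < s.re} ∪ Metric.ball (1 : ℂ) δ))
    (hG' : DifferentiableOn ℂ G' ({s : ℂ | 1 < s.re} ∪ Metric.ball (1 : ℂ) δ))
    (hGL : ∀ s : ℂ, σ < s.re → G s = (s - 1) ^ k * partialAsaiL S c A η s)
    (hGL' : ∀ s : ℂ, σ < s.re → G' s = (s - 1) ^ k' * partialAsaiL S c A (-η) s)
    (hG1 : G 1 ≠ 0) (hG'1 : G' 1 ≠ 0) : k = 0 := by
  rcases Nat.eq_zero_or_pos k with hk | hk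
  · exact hk
  · exfalso
    obtain ⟨m, rfl⟩ : ∃ m, k = m + 1 := ⟨k - 1, by omega⟩
    have hfac := eventually_mul_eq_pow_mul_partialPairL h2 hc hinert hσ hmulA hmulP hRhol hG hG'
      hGL hGL'
    have hfac' : ∀ᶠ s in 𝓝[{s : ℂ | 1 < s.re}] (1 : ℂ), G s * G' s = (s - 1) ^ ((m + k') + 1) *
        partialPairL {w : HeightOneSpectrum (𝓞 E) | w.under (𝓞 F) ∈ S} A (fun w => A (c • w)) s :=
      hfac.mono fun s hs => by rw [hs, Nat.add_right_comm]
    have h0 := apply_one_mul_apply_one_eq_zero_of_finite_pow hδ hG hG' hfin hfac'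
    rcases mul_eq_zero.mp h0 with h | h
    · exact hG1 h
    · exact hG'1 h

end Asai

/-! ### The named fact from holomorphy plus Jacquet–Shalika for the pair `(Π, Π^c)` -/

/-- **Grbac–Shahidi 2015, Thm. 4.3 at `s = 1` (the named fact `GrbacShahidi2015_partialAsaiL_at_one`)
follows from the HOLOMORPHY of the continued partial Asai `L`-functions near `{Re s ≥ 1}` and
Jacquet–Shalika's theorem for the Rankin–Selberg function of `(Π, Π^c)`** — the Rankin–Selberg half
of the printed proof (identity `(∗∗)` p. 205 and Remark 4.4), proved; the Langlands–Shahidi half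
(Thm. 4.1 with Thm. 2.1: holomorphy) isolated as the hypothesis `hHol`.

* `hHol` (holomorphy content of Thm. 4.3 (1) "`L(s, σ, r_A)` is entire" and (2)(a) "entire, except
  for possible simple poles at `s = 0` and `s = 1`", for the partial functions of a unitary cuspidal
  `Π`; unconditional for `Re(z) ≥ 1` by Remark 4.2 and §4.C): for `[E : F] = 2`, `c ≠ 1`, a cuspidal
  datum `Π` on `GL_N(𝔸_E)`, `N ≥ 1`, unitary a.e. (`|det t_{Π,w}| = 1` a.e.), an Asai datum `(S, A)`
  and a sign `η`: `σ₀ ≥ 1`, `δ > 0` and `G` holomorphic on `{1 < Re s} ∪ B(1, δ)` with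
  `G(s) = (s - 1) L^S(s, Π, As^η)` for `Re s > σ₀`, and `G(1) = 0` if `Π` is not conjugate self-dual
  a.e. (`IsConjSelfDualAE`; for cuspidal `Π` this is `Π^c ≇ Π^∨` by strong multiplicity one, and
  "Galois self-dual" forces the unitary normalisation of p. 190).
* `hRS` (Arthur–Clozel, Ch. 3, (2.1)–(2.3) = Jacquet–Shalika, for the pair `(Π, Π^c)`, `t_{Π^c,w} =
  t_{Π, c w}`, at `s₀ = 1`; `1 ∈ X` iff `t_{Π,w} = t_{Π, cw}⁻¹` a.e. iff `IsConjSelfDualAE`): the raw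
  product `R(s) = L^{S_E}(s, A ⊗ A^c)` is multipliable and holomorphic on `{1 < Re s}`,
  `(s - 1) R(s) → r ≠ 0` at `1⁺` in the conjugate self-dual case and `R(s) → r ≠ 0` otherwise — the
  tree's `JacquetShalika1981_partialPairL_{multipliable,boundary,pole}_repData` for `(Π, Π^c)`, kept as a
  hypothesis for want of the Galois-conjugate Borel–Jacquet datum `Π^c`.

Proof: clause (i) is `CuspidalAutomorphicRepData.exists_multipliable_asaiEulerFactors`; take `σ₀` the
largest and `δ` the least of the bounds for both signs; `(∗∗)` near `1⁺`
(`eventually_mul_eq_sq_mul_partialPairL`); then `exists_continuation_partialAsaiL_at_one_of_pairL_pole`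
in the conjugate self-dual case and `…_of_pairL_finite` otherwise.
[cite: GrbacShahidi2015, Thm. 4.3 and its proof, pp. 204–206, Remarks 4.2 and 4.4]
[cite: ArthurClozelAMS120, Ch. 3 §2 (2.1)–(2.3)] -/
theorem GrbacShahidi2015_partialAsaiL_at_one_of_holomorphy
    (hHol : ∀ (F E : Type) [Field F] [NumberField F] [Field E] [NumberField E] [Algebra F E]
      (c : E ≃ₐ[F] E), Module.finrank F E = 2 → c ≠ 1 →
      ∀ (N : ℕ) (hcpt : isCompact_glFiniteIntegralLevel N E)
        (π : CuspidalAutomorphicRepData N E hcpt), 0 < N →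
        (∀ᶠ w : HeightOneSpectrum (𝓞 E) in cofinite, ∀ α : Multiset ℂ,
          π.1.HasSatakeParamAt w α → ‖α.prod‖ = 1) →
        ∀ (S : Set (HeightOneSpectrum (𝓞 F))) (A : SatakeFamily E) (η : ℤˣ),
          π.1.IsAsaiDatum c S A →
          ∃ σ₀ : ℝ, 1 ≤ σ₀ ∧ ∃ δ : ℝ, 0 < δ ∧ ∃ G : ℂ → ℂ,
            DifferentiableOn ℂ G ({s : ℂ | 1 < s.re} ∪ Metric.ball 1 δ) ∧
            (∀ s : ℂ, σ₀ < s.re → G s = (s - 1) * partialAsaiL S c A η s) ∧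
            (¬ π.1.IsConjSelfDualAE c → G 1 = 0))
    (hRS : ∀ (F E : Type) [Field F] [NumberField F] [Field E] [NumberField E] [Algebra F E]
      (c : E ≃ₐ[F] E), Module.finrank F E = 2 → c ≠ 1 →
      ∀ (N : ℕ) (hcpt : isCompact_glFiniteIntegralLevel N E)
        (π : CuspidalAutomorphicRepData N E hcpt), 0 < N →
        (∀ᶠ w : HeightOneSpectrum (𝓞 E) in cofinite, ∀ α : Multiset ℂ,
          π.1.HasSatakeParamAt w α → ‖α.prod‖ = 1) →
        ∀ (S : Set (HeightOneSpectrum (𝓞 F))) (A : SatakeFamily E), π.1.IsAsaiDatum c S A →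
          (∀ s : ℂ, 1 < s.re →
            Multipliable fun w : {w : HeightOneSpectrum (𝓞 E) // w.under (𝓞 F) ∉ S} =>
              ((satakePairPolynomial (A w.1) (A (c • w.1))).eval
                ((w.1.residueCard : ℂ) ^ (-s)))⁻¹) ∧
          DifferentiableOn ℂ
            (partialPairL {w : HeightOneSpectrum (𝓞 E) | w.under (𝓞 F) ∈ S} A (fun w => A (c • w)))
            {s : ℂ | 1 < s.re} ∧
          (π.1.IsConjSelfDualAE c → ∃ r : ℂ, r ≠ 0 ∧
            Tendsto (fun s => (s - 1) *
                partialPairL {w : HeightOneSpectrum (𝓞 E) | w.under (𝓞 F) ∈ S} A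
                  (fun w => A (c • w)) s)
              (𝓝[{s : ℂ | 1 < s.re}] 1) (𝓝 r)) ∧
          (¬ π.1.IsConjSelfDualAE c → ∃ r : ℂ, r ≠ 0 ∧
            Tendsto
              (partialPairL {w : HeightOneSpectrum (𝓞 E) | w.under (𝓞 F) ∈ S} A (fun w => A (c • w)))
              (𝓝[{s : ℂ | 1 < s.re}] 1) (𝓝 r))) :
    GrbacShahidi2015_partialAsaiL_at_one := by
  intro F E _ _ _ _ _ c h2 hc N hcpt π hN hu S A η hSA
  -- clause (i) for both signs, holomorphy for both signs, Jacquet–Shalika for `(Π, Π^c)`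
  obtain ⟨σ₁, hσ₁, hmulA⟩ := π.exists_multipliable_asaiEulerFactors h2 hN hSA
  obtain ⟨σp, _, δp, hδp, Gp, hGp, hGLp, hGp1⟩ := hHol F E c h2 hc N hcpt π hN hu S A 1 hSA
  obtain ⟨σm, _, δm, hδm, Gm, hGm, hGLm, hGm1⟩ := hHol F E c h2 hc N hcpt π hN hu S A (-1) hSA
  obtain ⟨hmulP, hRhol, hpole, hfin⟩ := hRS F E c h2 hc N hcpt π hN hu S A hSA
  -- common half-plane `{σ < Re s}` and common ball `B(1, δ)`
  set σ : ℝ := max σ₁ (max σp σm) with hσdef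
  set δ : ℝ := min δp δm with hδdef
  have hδ : 0 < δ := lt_min hδp hδm
  have hσ₁σ : σ₁ ≤ σ := le_max_left _ _
  have hσ : 1 ≤ σ := hσ₁.trans hσ₁σ
  have hσpσ : σp ≤ σ := (le_max_left _ _).trans (le_max_right _ _)
  have hσmσ : σm ≤ σ := (le_max_right _ _).trans (le_max_right _ _)
  have hUp : {s : ℂ | 1 < s.re} ∪ Metric.ball (1 : ℂ) δ ⊆ {s : ℂ | 1 < s.re} ∪ Metric.ball 1 δp :=
    Set.union_subset_union_right _ (Metric.ball_subset_ball (min_le_left _ _))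
  have hUm : {s : ℂ | 1 < s.re} ∪ Metric.ball (1 : ℂ) δ ⊆ {s : ℂ | 1 < s.re} ∪ Metric.ball 1 δm :=
    Set.union_subset_union_right _ (Metric.ball_subset_ball (min_le_right _ _))
  have hmulA' : ∀ (θ : ℤˣ) (s : ℂ), σ < s.re →
      Multipliable fun v : {v : HeightOneSpectrum (𝓞 F) // v ∉ S} =>
        ((asaiLocalPolynomial c A θ (placeAbove E v.1)).eval ((v.1.residueCard : ℂ) ^ (-s)))⁻¹ :=
    fun θ s hs => hmulA θ s (lt_of_le_of_lt hσ₁σ hs)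
  have hmulP' : ∀ s : ℂ, σ < s.re →
      Multipliable fun w : {w : HeightOneSpectrum (𝓞 E) // w.under (𝓞 F) ∉ S} =>
        ((satakePairPolynomial (A w.1) (A (c • w.1))).eval ((w.1.residueCard : ℂ) ^ (-s)))⁻¹ :=
    fun s hs => hmulP s (lt_of_le_of_lt hσ hs)
  have hGLp' : ∀ s : ℂ, σ < s.re → Gp s = (s - 1) * partialAsaiL S c A 1 s :=
    fun s hs => hGLp s (lt_of_le_of_lt hσpσ hs)
  have hGLm' : ∀ s : ℂ, σ < s.re → Gm s = (s - 1) * partialAsaiL S c A (-1) s :=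
    fun s hs => hGLm s (lt_of_le_of_lt hσmσ hs)
  have hinert : ∀ w : HeightOneSpectrum (𝓞 E), w.under (𝓞 F) ∉ S → c • w = w →
      w.asIdeal.inertiaDeg (𝓞 F) = 2 := fun w hw hcw => hSA.inertiaDeg_eq_two hw hcw
  -- the `s = 1` clause on `{σ < Re s}`, by cases on conjugate self-duality
  have key : ∃ (k : ℕ) (δ' : ℝ) (G : ℂ → ℂ), k ≤ 1 ∧ 0 < δ' ∧
      DifferentiableOn ℂ G ({s : ℂ | 1 < s.re} ∪ Metric.ball 1 δ') ∧
      (∀ s : ℂ, σ < s.re → G s = (s - 1) ^ k * partialAsaiL S c A η s) ∧ G 1 ≠ 0 := by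
    by_cases hcsd : π.1.IsConjSelfDualAE c
    · obtain ⟨r, hr, hr'⟩ := hpole hcsd
      exact exists_continuation_partialAsaiL_at_one_of_pairL_pole h2 hc hinert hσ hδ hmulA' hmulP'
        hRhol hr hr' (hGp.mono hUp) (hGm.mono hUm) hGLp' hGLm' η
    · obtain ⟨r, hr, hr'⟩ := hfin hcsd
      exact exists_continuation_partialAsaiL_at_one_of_pairL_finite h2 hc hinert hσ hδ hmulA' hmulP'
        hRhol hr hr' (hGp.mono hUp) (hGm.mono hUm) hGLp' hGLm' (hGp1 hcsd) (hGm1 hcsd) η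
  obtain ⟨k, δ', G, hk, hδ', hG, hGL, hG1⟩ := key
  exact ⟨σ, hσ, fun s hs => hmulA' η s hs, k, δ', G, hk, hδ', hG, hGL, hG1⟩

/-- **Conversely, the named fact implies the holomorphy hypothesis `hHol`, granted Jacquet–Shalika
for `(Π, Π^c)`.** From the `s = 1` clause for `η` (`G = (s - 1)^k L^S`, `G(1) ≠ 0`, `k ≤ 1`) the
function `(s - 1)^{1-k} G` continues `(s - 1) L^S(s, Π, As^η)`; and if `Π` is not conjugate self-dual
a.e. then `L^{S_E}(s, Π × Π^c)` is finite at `1` (Arthur–Clozel (2.2), `1 ∉ X`), so comparing with the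
clause for `-η` through `(∗∗)` forces `k = 0` (`eq_zero_of_clauses_of_pairL_finite`), i.e. the
continuation vanishes at `1`. Only the multipliability, holomorphy and finite-limit parts of `hRS`
are used. [cite: GrbacShahidi2015, Thm. 4.3 (1) and Remark 4.4] [cite: ArthurClozelAMS120, Ch. 3 §2 (2.2)] -/
theorem GrbacShahidi2015_partialAsaiL_at_one.hol_of_pairL (hGS : GrbacShahidi2015_partialAsaiL_at_one)
    (hRS : ∀ (F E : Type) [Field F] [NumberField F] [Field E] [NumberField E] [Algebra F E]
      (c : E ≃ₐ[F] E), Module.finrank F E = 2 → c ≠ 1 →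
      ∀ (N : ℕ) (hcpt : isCompact_glFiniteIntegralLevel N E)
        (π : CuspidalAutomorphicRepData N E hcpt), 0 < N →
        (∀ᶠ w : HeightOneSpectrum (𝓞 E) in cofinite, ∀ α : Multiset ℂ,
          π.1.HasSatakeParamAt w α → ‖α.prod‖ = 1) →
        ∀ (S : Set (HeightOneSpectrum (𝓞 F))) (A : SatakeFamily E), π.1.IsAsaiDatum c S A →
          (∀ s : ℂ, 1 < s.re →
            Multipliable fun w : {w : HeightOneSpectrum (𝓞 E) // w.under (𝓞 F) ∉ S} =>
              ((satakePairPolynomial (A w.1) (A (c • w.1))).eval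
                ((w.1.residueCard : ℂ) ^ (-s)))⁻¹) ∧
          DifferentiableOn ℂ
            (partialPairL {w : HeightOneSpectrum (𝓞 E) | w.under (𝓞 F) ∈ S} A (fun w => A (c • w)))
            {s : ℂ | 1 < s.re} ∧
          (π.1.IsConjSelfDualAE c → ∃ r : ℂ, r ≠ 0 ∧
            Tendsto (fun s => (s - 1) *
                partialPairL {w : HeightOneSpectrum (𝓞 E) | w.under (𝓞 F) ∈ S} A
                  (fun w => A (c • w)) s)
              (𝓝[{s : ℂ | 1 < s.re}] 1) (𝓝 r)) ∧
          (¬ π.1.IsConjSelfDualAE c → ∃ r : ℂ, r ≠ 0 ∧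
            Tendsto
              (partialPairL {w : HeightOneSpectrum (𝓞 E) | w.under (𝓞 F) ∈ S} A (fun w => A (c • w)))
              (𝓝[{s : ℂ | 1 < s.re}] 1) (𝓝 r))) :
    ∀ (F E : Type) [Field F] [NumberField F] [Field E] [NumberField E] [Algebra F E]
      (c : E ≃ₐ[F] E), Module.finrank F E = 2 → c ≠ 1 →
      ∀ (N : ℕ) (hcpt : isCompact_glFiniteIntegralLevel N E)
        (π : CuspidalAutomorphicRepData N E hcpt), 0 < N →
        (∀ᶠ w : HeightOneSpectrum (𝓞 E) in cofinite, ∀ α : Multiset ℂ,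
          π.1.HasSatakeParamAt w α → ‖α.prod‖ = 1) →
        ∀ (S : Set (HeightOneSpectrum (𝓞 F))) (A : SatakeFamily E) (η : ℤˣ),
          π.1.IsAsaiDatum c S A →
          ∃ σ₀ : ℝ, 1 ≤ σ₀ ∧ ∃ δ : ℝ, 0 < δ ∧ ∃ G : ℂ → ℂ,
            DifferentiableOn ℂ G ({s : ℂ | 1 < s.re} ∪ Metric.ball 1 δ) ∧
            (∀ s : ℂ, σ₀ < s.re → G s = (s - 1) * partialAsaiL S c A η s) ∧
            (¬ π.1.IsConjSelfDualAE c → G 1 = 0) := by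
  intro F E _ _ _ _ _ c h2 hc N hcpt π hN hu S A η hSA
  obtain ⟨σ₀, hσ₀, hmul, k, δ, G, hk, hδ, hG, hGL, hG1⟩ := hGS F E c h2 hc N hcpt π hN hu S A η hSA
  obtain ⟨σ₀', _, hmul', k', δ', G', _, hδ', hG', hGL', hG'1⟩ :=
    hGS F E c h2 hc N hcpt π hN hu S A (-η) hSA
  obtain ⟨hmulP, hRhol, -, hfin⟩ := hRS F E c h2 hc N hcpt π hN hu S A hSA
  set σ : ℝ := max σ₀ σ₀' with hσdef
  have hσ : 1 ≤ σ := hσ₀.trans (le_max_left _ _)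
  have hGLσ : ∀ s : ℂ, σ < s.re → G s = (s - 1) ^ k * partialAsaiL S c A η s :=
    fun s hs => hGL s (lt_of_le_of_lt (le_max_left _ _) hs)
  have hGL'σ : ∀ s : ℂ, σ < s.re → G' s = (s - 1) ^ k' * partialAsaiL S c A (-η) s :=
    fun s hs => hGL' s (lt_of_le_of_lt (le_max_right _ _) hs)
  obtain ⟨G₀, hG₀, hG₀L, hG₀1⟩ := exists_continuation_sub_one_mul_of_clause hk hG hGLσ
  refine ⟨σ, hσ, δ, hδ, G₀, hG₀, hG₀L, fun hn => hG₀1 ?_⟩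
  -- off `X` the Rankin–Selberg function is finite at `1`, so `k = 0`
  obtain ⟨r, -, hr'⟩ := hfin hn
  have hδ'' : 0 < min δ δ' := lt_min hδ hδ'
  have hmulA : ∀ (θ : ℤˣ) (s : ℂ), σ < s.re →
      Multipliable fun v : {v : HeightOneSpectrum (𝓞 F) // v ∉ S} =>
        ((asaiLocalPolynomial c A θ (placeAbove E v.1)).eval ((v.1.residueCard : ℂ) ^ (-s)))⁻¹ := by
    intro θ s hs
    by_cases hθ : θ = η
    · rw [hθ]
      exact hmul s (lt_of_le_of_lt (le_max_left _ _) hs)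
    · rw [Int.units_ne_iff_eq_neg.mp hθ]
      exact hmul' s (lt_of_le_of_lt (le_max_right _ _) hs)
  exact eq_zero_of_clauses_of_pairL_finite h2 hc (fun w hw hcw => hSA.inertiaDeg_eq_two hw hcw) hσ
    hδ'' hmulA (fun s hs => hmulP s (lt_of_le_of_lt hσ hs)) hRhol hr'
    (hG.mono (Set.union_subset_union_right _ (Metric.ball_subset_ball (min_le_left _ _))))
    (hG'.mono (Set.union_subset_union_right _ (Metric.ball_subset_ball (min_le_right _ _))))
    hGLσ hGL'σ hG1 hG'1

/-- **Granted Jacquet–Shalika for the pair `(Π, Π^c)`, the named fact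
`GrbacShahidi2015_partialAsaiL_at_one` is EQUIVALENT to the pure holomorphy statement `hHol`** (at
most a simple pole at `s = 1` of the continued partial Asai `L`-functions on `{1 < Re s} ∪ B(1, δ)`,
and no pole unless `Π` is conjugate self-dual a.e.): the Rankin–Selberg half of Grbac–Shahidi's
proof (`(∗∗)` and Remark 4.4) supplies orders and non-vanishing at `1` in one direction and is undone
in the other. This identifies what the tree is missing for the fact: the Langlands–Shahidi
holomorphy (Thm. 4.1 with Thm. 2.1; unconditional on `Re(z) ≥ 1` by Remark 4.2 and §4.C).
[cite: GrbacShahidi2015, Thm. 4.3, Remarks 4.2 and 4.4] [cite: ArthurClozelAMS120, Ch. 3 §2 (2.1)–(2.3)] -/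
theorem GrbacShahidi2015_partialAsaiL_at_one_iff_holomorphy
    (hRS : ∀ (F E : Type) [Field F] [NumberField F] [Field E] [NumberField E] [Algebra F E]
      (c : E ≃ₐ[F] E), Module.finrank F E = 2 → c ≠ 1 →
      ∀ (N : ℕ) (hcpt : isCompact_glFiniteIntegralLevel N E)
        (π : CuspidalAutomorphicRepData N E hcpt), 0 < N →
        (∀ᶠ w : HeightOneSpectrum (𝓞 E) in cofinite, ∀ α : Multiset ℂ,
          π.1.HasSatakeParamAt w α → ‖α.prod‖ = 1) →
        ∀ (S : Set (HeightOneSpectrum (𝓞 F))) (A : SatakeFamily E), π.1.IsAsaiDatum c S A →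
          (∀ s : ℂ, 1 < s.re →
            Multipliable fun w : {w : HeightOneSpectrum (𝓞 E) // w.under (𝓞 F) ∉ S} =>
              ((satakePairPolynomial (A w.1) (A (c • w.1))).eval
                ((w.1.residueCard : ℂ) ^ (-s)))⁻¹) ∧
          DifferentiableOn ℂ
            (partialPairL {w : HeightOneSpectrum (𝓞 E) | w.under (𝓞 F) ∈ S} A (fun w => A (c • w)))
            {s : ℂ | 1 < s.re} ∧
          (π.1.IsConjSelfDualAE c → ∃ r : ℂ, r ≠ 0 ∧
            Tendsto (fun s => (s - 1) *
                partialPairL {w : HeightOneSpectrum (𝓞 E) | w.under (𝓞 F) ∈ S} A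
                  (fun w => A (c • w)) s)
              (𝓝[{s : ℂ | 1 < s.re}] 1) (𝓝 r)) ∧
          (¬ π.1.IsConjSelfDualAE c → ∃ r : ℂ, r ≠ 0 ∧
            Tendsto
              (partialPairL {w : HeightOneSpectrum (𝓞 E) | w.under (𝓞 F) ∈ S} A (fun w => A (c • w)))
              (𝓝[{s : ℂ | 1 < s.re}] 1) (𝓝 r))) :
    GrbacShahidi2015_partialAsaiL_at_one ↔
      ∀ (F E : Type) [Field F] [NumberField F] [Field E] [NumberField E] [Algebra F E]
        (c : E ≃ₐ[F] E), Module.finrank F E = 2 → c ≠ 1 →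
        ∀ (N : ℕ) (hcpt : isCompact_glFiniteIntegralLevel N E)
          (π : CuspidalAutomorphicRepData N E hcpt), 0 < N →
          (∀ᶠ w : HeightOneSpectrum (𝓞 E) in cofinite, ∀ α : Multiset ℂ,
            π.1.HasSatakeParamAt w α → ‖α.prod‖ = 1) →
          ∀ (S : Set (HeightOneSpectrum (𝓞 F))) (A : SatakeFamily E) (η : ℤˣ),
            π.1.IsAsaiDatum c S A →
            ∃ σ₀ : ℝ, 1 ≤ σ₀ ∧ ∃ δ : ℝ, 0 < δ ∧ ∃ G : ℂ → ℂ,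
              DifferentiableOn ℂ G ({s : ℂ | 1 < s.re} ∪ Metric.ball 1 δ) ∧
              (∀ s : ℂ, σ₀ < s.re → G s = (s - 1) * partialAsaiL S c A η s) ∧
              (¬ π.1.IsConjSelfDualAE c → G 1 = 0) :=
  ⟨fun h => h.hol_of_pairL hRS, fun h => GrbacShahidi2015_partialAsaiL_at_one_of_holomorphy h hRS⟩

/-- **The conjugate-self-dual stratum of the holomorphy hypothesis `hHol` is contained in Mok's
dichotomy in continuation form** (`Mok2014_partialAsaiL_continuation_pole_dichotomy`; Grbac–Shahidi
Thm. 4.3 (2)): for a conjugate self-dual cuspidal `Π` with pole sign `η₀`, the continuation `G` of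
`(s - 1) L^S(s, Π, As^{η₀})` to `{1/2 < Re s}` and `(s - 1) H` for the continuation `H` of
`L^S(s, Π, As^{-η₀})` serve, restricted to `{1 < Re s} ∪ B(1, 1/2) ⊆ {1/2 < Re s}`; the vanishing
clause is void. Hence what the tree lacks for `hHol` is exactly its non-conjugate-self-dual stratum
(Thm. 4.3 (1): "`L(s, σ, r_A)` is entire", holomorphy part, for the partial functions).
[cite: GrbacShahidi2015, Thm. 4.3 (2)(a)] [cite: Mok2014, §2.5 and Thm. 2.5.4 (a)] -/
theorem hol_of_Mok2014_partialAsaiL_continuation_pole_dichotomy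
    (hMok : Mok2014_partialAsaiL_continuation_pole_dichotomy)
    {F E : Type} [Field F] [NumberField F] [Field E] [NumberField E] [Algebra F E]
    {c : E ≃ₐ[F] E} (h2 : Module.finrank F E = 2) (hc : c ≠ 1)
    {N : ℕ} {hcpt : isCompact_glFiniteIntegralLevel N E} (π : CuspidalAutomorphicRepData N E hcpt)
    (hN : 0 < N) (hπ : π.1.IsConjSelfDualAE c)
    {S : Set (HeightOneSpectrum (𝓞 F))} {A : SatakeFamily E} (η : ℤˣ) (hSA : π.1.IsAsaiDatum c S A) :
    ∃ σ₀ : ℝ, 1 ≤ σ₀ ∧ ∃ δ : ℝ, 0 < δ ∧ ∃ G : ℂ → ℂ,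
      DifferentiableOn ℂ G ({s : ℂ | 1 < s.re} ∪ Metric.ball 1 δ) ∧
      (∀ s : ℂ, σ₀ < s.re → G s = (s - 1) * partialAsaiL S c A η s) ∧
      (¬ π.1.IsConjSelfDualAE c → G 1 = 0) := by
  obtain ⟨η₀, hη₀⟩ := hMok F E c h2 hc N hcpt π hN hπ
  obtain ⟨σ₀, hσ₀, -, ⟨G, hG, hGL, -⟩, ⟨H, hH, hHL, -⟩⟩ := hη₀ S A hSA
  by_cases hη : η = η₀
  · subst hη
    exact ⟨σ₀, hσ₀, 1 / 2, one_half_pos, G, hG.mono one_lt_re_union_ball_one_half_subset, hGL,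
      fun hn => absurd hπ hn⟩
  · obtain rfl : η = -η₀ := Int.units_ne_iff_eq_neg.mp hη
    exact ⟨σ₀, hσ₀, 1 / 2, one_half_pos, fun s => (s - 1) * H s,
      ((differentiableOn_id.sub_const 1).mul hH).mono one_lt_re_union_ball_one_half_subset,
      fun s hs => by show (s - 1) * H s = _; rw [hHL s hs], fun hn => absurd hπ hn⟩

end Literature.NumberTheory.Automorphic

end
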